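import Mathlib
import Literature.NumberTheory.Irrationality.Zudilin2014.FirstTale
import Summits.KontsevichZagierPeriods.Zeta5Search.TwoTaleOmega.FormalBarnesOps

/-!
# Formal Barnes functionals — the RESIDUE CRITERION and iterated block operations (blueprint F10, generic part)

HONEST FRAMING: systematic search; no irrationality claim unless certified. Pure finite algebra over `ℚ`; no named
fact, no `sorry`.

The per-direction "legitimacy" conditions of the (bmiss)@Ω recurrences (RECURRENCE.md §13.10 (5)) are statements
`ρ⁰_s(G) = 0`, `ρ¹_s(G) = 0` about the formal residues of a telescoped datum `G`. `ρ¹_s(G) = 2·G.simple(−s)` is a support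
fact; `ρ⁰_s(G)` is the DERIVATIVE of `G` at the regular point `t = s`, and this file turns "`G` has a double zero at `s`"
into `ρ⁰_s(G) = 0` WITHOUT calculus:

* dividing twice by `(t + c)` at a regular point `c ∉ poles` exposes the value and the derivative as COEFFICIENTS:
  `((v.divLin c).divLin c).double c = v.eval (−c)` and `((v.divLin c).divLin c).simple c = rho0 (−c) v`
  (`divLin_divLin_double_self`, `divLin_divLin_simple_self`);
* hence the **residue criterion** (`rho0_eq_zero_of_sq_mul`): if `v(t) = (t + c)² · w(t)` off a finite set, for data `w`
  with no pole at `c`, then `rho0 (−c) v = 0` and `v.eval (−c) = 0` — by Lemma U (`PF.eq_of_eval_eq`) applied to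
  `(v.divLin c).divLin c` and `w`;
* for the second tale the formal residue IS a value: `altRes0 M v = sgnZ M · v.eval M` — no criterion needed beyond
  evaluation (`FormalBarnesT.altRes0` unfolds to this; recorded in `FormalBarnesTLink`/instances);
* iterated block operations `mulBlock lo n` / `divBlock lo n` (multiply / divide by `∏_{i<n} (t + lo + i)`), with their
  `eval` and `poles` lemmas and the bridge `prod_range_eq_eval_block` to `FirstTale.block`, so that an instance can build
  the data of `Cert(p;t)·F(p;t)` and of the quotient `G/(t−s)²` by ops alone.
-/

open Finset Polynomial
open Literature.NumberTheory.Irrationality.Zudilin2014 (block eval_block block_mul_block)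

namespace Summit.KontsevichZagierPeriods.Zeta5Search.FormalBarnes

namespace PF

variable (v : PF) (c : ℤ)

/-! ### Coefficients of `divLin` -/

/-- The new double coefficient at `c` is the old simple coefficient. -/
theorem divLin_double_self : (v.divLin c).double c = v.simple c := by
  simp [divLin, Finsupp.onFinset_apply]

/-- Away from `c`, `divLin` divides the double coefficients by `(c − k)`. -/
theorem divLin_double_of_ne {k : ℤ} (hk : k ≠ c) : (v.divLin c).double k = v.double k / ((c : ℚ) - k) := by
  simp [divLin, Finsupp.onFinset_apply, hk]

/-- Away from `c`, the new simple coefficient. -/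
theorem divLin_simple_of_ne {k : ℤ} (hk : k ≠ c) :
    (v.divLin c).simple k = v.simple k / ((c : ℚ) - k) - v.double k / ((c : ℚ) - k) ^ 2 := by
  simp [divLin, Finsupp.onFinset_apply, hk]

/-- The new simple coefficient at `c` (general form). -/
theorem divLin_simple_self : (v.divLin c).simple c
    = v.poly.eval (-(c : ℚ)) - ∑ j ∈ v.poles.erase c, v.simple j / ((c : ℚ) - j)
      + ∑ j ∈ v.poles.erase c, v.double j / ((c : ℚ) - j) ^ 2 := by
  simp [divLin, Finsupp.onFinset_apply]

/-- If `c` is not a pole, `v.simple c = 0`. -/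
theorem simple_eq_zero_of_notMem {v : PF} {c : ℤ} (hc : c ∉ v.poles) : v.simple c = 0 := by
  by_contra h; exact hc (v.simple_support_subset_poles (Finsupp.mem_support_iff.2 h))

/-- If `c` is not a pole, `v.double c = 0`. -/
theorem double_eq_zero_of_notMem {v : PF} {c : ℤ} (hc : c ∉ v.poles) : v.double c = 0 := by
  by_contra h; exact hc (v.double_support_subset_poles (Finsupp.mem_support_iff.2 h))

/-- The value of `v` at an integer point `−c` as a sum over the pole set (junk conventions agree at poles). -/
theorem eval_neg_eq_sum (v : PF) (c : ℤ) : v.eval (-(c : ℚ))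
    = v.poly.eval (-(c : ℚ)) - ∑ j ∈ v.poles, v.simple j / ((c : ℚ) - j)
      + ∑ j ∈ v.poles, v.double j / ((c : ℚ) - j) ^ 2 := by
  unfold PF.eval
  rw [Finsupp.sum_of_support_subset _ v.simple_support_subset_poles _ (fun _ _ => by simp),
    Finsupp.sum_of_support_subset _ v.double_support_subset_poles _ (fun _ _ => by simp)]
  have h1 : ∑ j ∈ v.poles, v.simple j / (-(c : ℚ) + j) = -∑ j ∈ v.poles, v.simple j / ((c : ℚ) - j) := by
    rw [← sum_neg_distrib]
    exact sum_congr rfl fun j _ => by rw [show (-(c : ℚ) + j) = -((c : ℚ) - j) by ring, div_neg]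
  have h2 : ∑ j ∈ v.poles, v.double j / (-(c : ℚ) + j) ^ 2 = ∑ j ∈ v.poles, v.double j / ((c : ℚ) - j) ^ 2 :=
    sum_congr rfl fun j _ => by rw [show (-(c : ℚ) + j) = -((c : ℚ) - j) by ring, neg_sq]
  rw [h1, h2]
  ring

/-- **At a regular point `c ∉ poles`, the new simple coefficient of `v/(t+c)` at `c` is the VALUE `v(−c)`.** -/
theorem divLin_simple_self_of_notMem {v : PF} {c : ℤ} (hc : c ∉ v.poles) :
    (v.divLin c).simple c = v.eval (-(c : ℚ)) := by
  rw [divLin_simple_self, eval_neg_eq_sum, erase_eq_of_notMem hc]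

/-- The polynomial part of `v/(t+c)` evaluated at `−c` is the DERIVATIVE of the polynomial part at `−c`. -/
theorem eval_divLin_poly_self : (v.divLin c).poly.eval (-(c : ℚ)) = (derivative v.poly).eval (-(c : ℚ)) := by
  have h := divByMonic_lin_mul v.poly c
  have hd := congrArg (fun P => (derivative P).eval (-(c : ℚ))) h
  simp only [derivative_mul, derivative_add, derivative_sub, derivative_X, derivative_C, add_zero, sub_zero,
    mul_one, Polynomial.eval_add, Polynomial.eval_mul, Polynomial.eval_X, Polynomial.eval_C, neg_add_cancel,
    mul_zero, zero_add] at hd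
  exact hd

/-! ### Dividing twice at a regular point: value and derivative as coefficients -/

/-- **`((v/(t+c))/(t+c))` has double coefficient `v(−c)` at `c`** (for `c ∉ poles`). -/
theorem divLin_divLin_double_self {v : PF} {c : ℤ} (hc : c ∉ v.poles) :
    ((v.divLin c).divLin c).double c = v.eval (-(c : ℚ)) := by
  rw [divLin_double_self, divLin_simple_self_of_notMem hc]

/-- **`((v/(t+c))/(t+c))` has simple coefficient `ρ⁰_{−c}(v)` (the derivative `v'(−c)`) at `c`** (for `c ∉ poles`). -/
theorem divLin_divLin_simple_self {v : PF} {c : ℤ} (hc : c ∉ v.poles) :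
    ((v.divLin c).divLin c).simple c = rho0 (-c) v := by
  rw [divLin_simple_self, eval_divLin_poly_self]
  -- the sums over `(v.divLin c).poles.erase c` can be taken over `v.poles`
  have hsub : (v.divLin c).poles.erase c ⊆ v.poles := fun k hk => by
    have := poles_divLin_subset c v (mem_of_mem_erase hk)
    exact (mem_insert.1 this).resolve_left (ne_of_mem_erase hk)
  have hS : ∀ (g : ℤ → ℚ), (∀ k, (v.divLin c).simple k = 0 → (v.divLin c).double k = 0 → g k = 0) →
      ∑ j ∈ (v.divLin c).poles.erase c, g j = ∑ j ∈ v.poles, g j := fun g hg =>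
    sum_subset hsub fun k hk hk' => by
      have hkc : k ≠ c := fun h => hc (h ▸ hk)
      have : k ∉ (v.divLin c).poles := fun h => hk' (mem_erase.2 ⟨hkc, h⟩)
      exact hg k (simple_eq_zero_of_notMem this) (double_eq_zero_of_notMem this)
  rw [hS _ (fun k h _ => by rw [h, zero_div]), hS _ (fun k _ h => by rw [h, zero_div])]
  have hne : ∀ j ∈ v.poles, j ≠ c := fun j hj h => hc (h ▸ hj)
  have hcj : ∀ j ∈ v.poles, ((c : ℚ) - j) ≠ 0 := fun j hj => sub_ne_zero.2 (by exact_mod_cast (hne j hj).symm)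
  have hA : ∑ j ∈ v.poles, (v.divLin c).simple j / ((c : ℚ) - j)
      = ∑ j ∈ v.poles, (v.simple j / ((c : ℚ) - j) ^ 2 - v.double j / ((c : ℚ) - j) ^ 3) :=
    sum_congr rfl fun j hj => by
      rw [divLin_simple_of_ne v c (hne j hj)]
      field_simp [hcj j hj]
  have hB : ∑ j ∈ v.poles, (v.divLin c).double j / ((c : ℚ) - j) ^ 2
      = ∑ j ∈ v.poles, v.double j / ((c : ℚ) - j) ^ 3 :=
    sum_congr rfl fun j hj => by rw [divLin_double_of_ne v c (hne j hj), div_div, ← pow_succ']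
  rw [hA, hB, sum_sub_distrib]
  unfold rho0
  rw [Finsupp.sum_of_support_subset _ v.simple_support_subset_poles _ (fun _ _ => by simp),
    Finsupp.sum_of_support_subset _ v.double_support_subset_poles _ (fun _ _ => by simp)]
  push_cast
  have hC : ∑ j ∈ v.poles, v.simple j / (-(c : ℚ) + j) ^ 2 = ∑ j ∈ v.poles, v.simple j / ((c : ℚ) - j) ^ 2 :=
    sum_congr rfl fun j _ => by rw [show (-(c : ℚ) + j) = -((c : ℚ) - j) by ring, neg_sq]
  have hD : ∑ j ∈ v.poles, 2 * v.double j / (-(c : ℚ) + j) ^ 3 = -(2 * ∑ j ∈ v.poles, v.double j / ((c : ℚ) - j) ^ 3) := by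
    rw [mul_sum, ← sum_neg_distrib]
    exact sum_congr rfl fun j hj => by
      rw [show (-(c : ℚ) + j) = -((c : ℚ) - j) by ring]
      field_simp [hcj j hj]
  rw [hC, hD]
  ring

/-! ### The residue criterion -/

/-- **Residue criterion (double zero ⟹ `ρ⁰ = 0`)**: if `v(t) = (t+c)²·w(t)` off the finite set `insert c S ⊇` all
poles, with `c` a pole of neither `v` nor `w`, then `ρ⁰_{−c}(v) = 0` and `v(−c) = 0`. -/
theorem rho0_eq_zero_of_sq_mul (v w : PF) (c : ℤ) (S : Finset ℤ) (hvS : v.poles ⊆ S) (hwS : w.poles ⊆ S)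
    (hc : c ∉ S) (h : ∀ t : ℚ, (∀ k ∈ insert c S, t + k ≠ 0) → v.eval t = (t + c) ^ 2 * w.eval t) :
    rho0 (-c) v = 0 ∧ v.eval (-(c : ℚ)) = 0 := by
  have hcv : c ∉ v.poles := fun h' => hc (hvS h')
  have hcw : c ∉ w.poles := fun h' => hc (hwS h')
  set u := (v.divLin c).divLin c with hu
  have huS : u.poles ⊆ insert c S := fun k hk => by
    have h1 := poles_divLin_subset c _ hk
    rcases mem_insert.1 h1 with h1 | h1
    · exact mem_insert.2 (Or.inl h1)
    · have h2 := poles_divLin_subset c v h1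
      exact insert_subset_insert _ hvS h2
  have hwS' : w.poles ⊆ insert c S := hwS.trans (subset_insert _ _)
  have hU := PF.eq_of_eval_eq u w (insert c S) (u.simple_support_subset_poles.trans huS)
    (u.double_support_subset_poles.trans huS) (w.simple_support_subset_poles.trans hwS')
    (w.double_support_subset_poles.trans hwS') (fun t ht => by
      have htc : t + c ≠ 0 := ht c (mem_insert_self _ _)
      have htv : ∀ k ∈ v.poles, t + k ≠ 0 := fun k hk => ht k (mem_insert_of_mem (hvS hk))
      have ht1 : ∀ k ∈ (v.divLin c).poles, t + k ≠ 0 := fun k hk =>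
        ht k (by rcases mem_insert.1 (poles_divLin_subset c v hk) with h | h
                 · exact h ▸ mem_insert_self _ _
                 · exact mem_insert_of_mem (hvS h))
      rw [hu, eval_divLin c _ (by rw [divLin_double_self]; exact simple_eq_zero_of_notMem hcv) t htc ht1,
        eval_divLin c v (double_eq_zero_of_notMem hcv) t htc htv, h t ht]
      field_simp)
  refine ⟨?_, ?_⟩
  · rw [← divLin_divLin_simple_self hcv, ← hu, hU.2.1]; exact simple_eq_zero_of_notMem hcw
  · rw [← divLin_divLin_double_self hcv, ← hu, hU.2.2]; exact double_eq_zero_of_notMem hcw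

/-- **Simple-zero criterion**: if `v(t) = (t+c)·w(t)` off `insert c S ⊇` all poles, `c` a pole of neither, then
`v(−c) = 0` (read off as the simple coefficient of `v/(t+c)` at `c`). -/
theorem eval_eq_zero_of_lin_mul (v w : PF) (c : ℤ) (S : Finset ℤ) (hvS : v.poles ⊆ S) (hwS : w.poles ⊆ S)
    (hc : c ∉ S) (h : ∀ t : ℚ, (∀ k ∈ insert c S, t + k ≠ 0) → v.eval t = (t + c) * w.eval t) :
    v.eval (-(c : ℚ)) = 0 := by
  have hcv : c ∉ v.poles := fun h' => hc (hvS h')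
  have hcw : c ∉ w.poles := fun h' => hc (hwS h')
  have huS : (v.divLin c).poles ⊆ insert c S := fun k hk => insert_subset_insert _ hvS (poles_divLin_subset c v hk)
  have hwS' : w.poles ⊆ insert c S := hwS.trans (subset_insert _ _)
  have hU := PF.eq_of_eval_eq (v.divLin c) w (insert c S) ((v.divLin c).simple_support_subset_poles.trans huS)
    ((v.divLin c).double_support_subset_poles.trans huS) (w.simple_support_subset_poles.trans hwS')
    (w.double_support_subset_poles.trans hwS') (fun t ht => by
      have htc : t + c ≠ 0 := ht c (mem_insert_self _ _)
      have htv : ∀ k ∈ v.poles, t + k ≠ 0 := fun k hk => ht k (mem_insert_of_mem (hvS hk))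
      rw [eval_divLin c v (double_eq_zero_of_notMem hcv) t htc htv, h t ht]
      field_simp)
  rw [← divLin_simple_self_of_notMem hcv, hU.2.1]; exact simple_eq_zero_of_notMem hcw

/-- `ρ¹` is a support fact: no pole of `v` at `t = s` ⟹ `ρ¹_s(v) = 0`. -/
theorem rho1_eq_zero_of_notMem {v : PF} {s : ℤ} (hs : -s ∉ v.poles) : rho1 s v = 0 := by
  unfold rho1; rw [simple_eq_zero_of_notMem hs, mul_zero]

/-! ### Iterated block operations -/

/-- Multiply by the block `∏_{i<n} (t + lo + i)`. -/
noncomputable def mulBlock (lo : ℤ) : ℕ → PF → PF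
  | 0, v => v
  | n + 1, v => (mulBlock lo n v).mulLin (lo + n)

/-- Divide by the block `∏_{i<n} (t + lo + i)` (one simple factor at a time). -/
noncomputable def divBlock (lo : ℤ) : ℕ → PF → PF
  | 0, v => v
  | n + 1, v => (divBlock lo n v).divLin (lo + n)

/-- `mulBlock` does not create poles. -/
theorem poles_mulBlock_subset (lo : ℤ) (n : ℕ) (v : PF) : (mulBlock lo n v).poles ⊆ v.poles := by
  induction n with
  | zero => exact subset_rfl
  | succ n ih => exact (poles_mulLin_subset _ _).trans ih

/-- Value of `mulBlock`: `(∏_{i<n} (t + lo + i)) · v(t)` off the poles. -/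
theorem eval_mulBlock (lo : ℤ) (n : ℕ) (v : PF) (t : ℚ) (ht : ∀ k ∈ v.poles, t + k ≠ 0) :
    (mulBlock lo n v).eval t = (∏ i ∈ range n, (t + ((lo + i : ℤ) : ℚ))) * v.eval t := by
  induction n with
  | zero => simp [mulBlock]
  | succ n ih =>
    rw [mulBlock, eval_mulLin _ _ t (fun k hk => ht k (poles_mulBlock_subset lo n v hk)), ih, prod_range_succ]
    push_cast; ring

/-- The poles of `divBlock lo n v` lie in `v.poles ∪ {lo, …, lo+n−1}`. -/
theorem poles_divBlock_subset (lo : ℤ) (n : ℕ) (v : PF) :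
    (divBlock lo n v).poles ⊆ v.poles ∪ (range n).image (fun i : ℕ => lo + i) := by
  induction n with
  | zero => simp [divBlock]
  | succ n ih =>
    intro k hk
    rw [divBlock] at hk
    rcases mem_insert.1 (poles_divLin_subset _ _ hk) with h | h
    · exact mem_union_right _ (mem_image.2 ⟨n, mem_range.2 (Nat.lt_succ_self n), h.symm⟩)
    · rcases mem_union.1 (ih h) with h' | h'
      · exact mem_union_left _ h'
      · obtain ⟨i, hi, rfl⟩ := mem_image.1 h'
        exact mem_union_right _ (mem_image.2 ⟨i, mem_range.2 ((mem_range.1 hi).trans (Nat.lt_succ_self n)), rfl⟩)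

/-- The double coefficients of `divBlock lo n v` away from the divided points are those of `v` up to nonzero factors;
in particular they vanish where `v`'s do. -/
theorem divBlock_double_eq_zero (lo : ℤ) (n : ℕ) (v : PF) (k : ℤ) (hk : v.double k = 0)
    (hkn : ∀ i < n, k ≠ lo + i) : (divBlock lo n v).double k = 0 := by
  induction n with
  | zero => simpa [divBlock] using hk
  | succ n ih =>
    rw [divBlock, divLin_double_of_ne _ _ (hkn n (Nat.lt_succ_self n)), ih (fun i hi => hkn i (hi.trans (Nat.lt_succ_self n))),
      zero_div]

/-- Value of `divBlock`: `v(t) / ∏_{i<n} (t + lo + i)` off the poles and the divided points, provided `v` has no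
double pole at the divided points. -/
theorem eval_divBlock (lo : ℤ) (n : ℕ) (v : PF) (hv : ∀ i < n, v.double (lo + i) = 0) (t : ℚ)
    (ht : ∀ k ∈ v.poles, t + k ≠ 0) (htn : ∀ i < n, t + ((lo + i : ℤ) : ℚ) ≠ 0) :
    (divBlock lo n v).eval t = v.eval t / ∏ i ∈ range n, (t + ((lo + i : ℤ) : ℚ)) := by
  induction n with
  | zero => simp [divBlock]
  | succ n ih =>
    have hguard : (divBlock lo n v).double (lo + n) = 0 :=
      divBlock_double_eq_zero lo n v (lo + n) (hv n (Nat.lt_succ_self n)) (fun i hi h => by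
        have : (i : ℤ) = n := by linarith
        exact absurd (by exact_mod_cast this : i = n) (Nat.ne_of_lt hi))
    have hpol : ∀ k ∈ (divBlock lo n v).poles, t + k ≠ 0 := fun k hk => by
      rcases mem_union.1 (poles_divBlock_subset lo n v hk) with h | h
      · exact ht k h
      · obtain ⟨i, hi, rfl⟩ := mem_image.1 h
        exact htn i ((mem_range.1 hi).trans (Nat.lt_succ_self n))
    rw [divBlock, eval_divLin _ _ hguard t (htn n (Nat.lt_succ_self n)) hpol,
      ih (fun i hi => hv i (hi.trans (Nat.lt_succ_self n))) (fun i hi => htn i (hi.trans (Nat.lt_succ_self n))),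
      prod_range_succ, div_div]

/-- Bridge to `FirstTale.block`: `∏_{i<n} (t + lo + i) = block lo (lo+n) (t)`. -/
theorem prod_range_eq_eval_block (lo : ℤ) (n : ℕ) (t : ℚ) :
    ∏ i ∈ range n, (t + ((lo + i : ℤ) : ℚ)) = (block lo (lo + n)).eval t := by
  induction n with
  | zero => simp [block]
  | succ n ih =>
    have hsingle : block (lo + n) (lo + n + 1) = X + C ((lo + n : ℤ) : ℚ) := by
      unfold block
      rw [show Ico (lo + n) (lo + n + 1) = {lo + (n : ℤ)} by ext j; simp; omega, prod_singleton]
    rw [prod_range_succ, ih, show lo + ((n + 1 : ℕ) : ℤ) = lo + n + 1 by push_cast; ring,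
      ← block_mul_block (show lo ≤ lo + n by omega) (show lo + (n : ℤ) ≤ lo + n + 1 by omega), hsingle,
      Polynomial.eval_mul, Polynomial.eval_add, Polynomial.eval_X, Polynomial.eval_C]

end PF

end Summit.KontsevichZagierPeriods.Zeta5Search.FormalBarnes
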